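import Summits.CriticalPhenomena.SAWScalingLimit.Theorems.SAWDefectDecoherenceBoundaryClosureRGateMassLawsArm
import Summits.CriticalPhenomena.SAWScalingLimit.Theorems.SAWDefectDecoherenceBoundaryClosureRFlatMassLaws
import HarnessLib

/-!
# Crux `BoundaryClosureR` (stmt-CriticalPhenomena-14004), line `pick-half-plane`:
the composed glue `stub_flatMassLaws ⇐ (a**) ∧ (b*)`

Landing target:
`Summits/CriticalPhenomena/SAWScalingLimit/Theorems/SAWDefectDecoherenceBoundaryClosureRFlatMassLawsGlue.lean`
(`--supports stmt-CriticalPhenomena-14004`).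

Composition of the two reductions of the sibling files: the density law (a) of `FlatMassLaws` from
(a**) POINTWISE two-sided comparability on both flat pieces (`…FlatMassLaws.lean`), and the root-arm
divergence (b) from (b*) the POINTWISE harmonic arm bound (`…GateMassLawsArm.lean`).

* **`stub_flatMassLaws_reduction`** (registered sub-goal, data level);
* **`flatMassLaws_of_pointwise`** (family level): in the skeleton,
  `exact flatMassLaws_of_pointwise hA hB` closes `stub_flatMassLaws : FlatMassLaws` from the two
  registered pointwise sub-stubs (a**) and (b*).

Sources: H. Duminil-Copin, S. Smirnov, Ann. of Math. 175 (2012), §3.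
-/

noncomputable section

open scoped BigOperators Topology
open Filter Set
open Literature.Probability.LatticeModels (HexVertex hexGraph hexCenter Site)
open Literature.Probability.RandomPlanarGeometry
open Literature.Probability.RandomPlanarGeometry.SAW

namespace Summit.CriticalPhenomena.SAWScalingLimit.Theorems.PickHalfPlane.GateMass

/-- **Registered sub-goal `stub_flatMassLaws_reduction`** (crux item stmt-CriticalPhenomena-14004, line
`pick-half-plane`, stub `stub_flatMassLaws`, DATA LEVEL): for a family pinned at `c` (rows `m δ`,
normaliser `b δ → c`) and at the root `x` (rows `mr δ`, roots `e δ → x`) and any weights `Z δ ≥ 0`,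
(a**) POINTWISE two-sided comparability of the columns of every ball `closedBall y ρ₀` of either flat
piece at distance `> 2ρ₀` from the root, and (b*) the HARMONIC ARM BOUND east of the root, imply the
two conclusions of `FlatMassLaws`: the uniform-in-scale density law (a) and the root-arm divergence (b).
[cite: DuminilCopinSmirnov2012, §3 (the boundary part α of the strip)] -/
theorem stub_flatMassLaws_reduction : ∀ (Λ : ℝ → Finset HexVertex) (m mr : ℝ → ℤ) (ρ r : ℝ) (c x : ℂ) (b e : ℝ → Sym2 HexVertex) (Z : ℝ → Sym2 HexVertex → ℝ), 0 < ρ → (∀ᶠ δ : ℝ in 𝓝[>] 0, ∀ v : HexVertex, (δ : ℂ) * hexCenter v ∈ Metric.ball c ρ → (v ∈ Λ δ ↔ m δ ≤ v.1 1)) → (∀ᶠ δ : ℝ in 𝓝[>] 0, b δ ∈ hexDomainBoundary (Λ δ)) → Tendsto (fun δ : ℝ => (δ : ℂ) * hexMidpoint (b δ)) (𝓝[>] 0) (𝓝 c) → 0 < r → (∀ᶠ δ : ℝ in 𝓝[>] 0, ∀ v : HexVertex, (δ : ℂ) * hexCenter v ∈ Metric.ball x r → (v ∈ Λ δ ↔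 mr δ ≤ v.1 1)) → (∀ᶠ δ : ℝ in 𝓝[>] 0, e δ ∈ hexDomainBoundary (Λ δ)) → Tendsto (fun δ : ℝ => (δ : ℂ) * hexMidpoint (e δ)) (𝓝[>] 0) (𝓝 x) → (∀ δ e', 0 ≤ Z δ e') → (∀ (y : ℂ) (ρ₀ : ℝ), 0 < ρ₀ → x ∉ Metric.closedBall y (2 * ρ₀) → (y.im = c.im → Metric.closedBall y ρ₀ ⊆ Metric.ball c ρ → ∃ C : ℝ, 0 < C ∧ ∀ᶠ δ : ℝ in 𝓝[>] 0, ∀ k : ℤ, (δ : ℂ) * hexMidpoint s((((![k, m δ - 1] : Site 2)), (1 : Fin 2)), ((![k, m δ] : Site 2), (0 : Fin 2))) ∈ Metric.ball y ρ₀ → C⁻¹ * Z δ (b δ) ≤ Z δ s((((![k, m δ - 1] : Site 2)), (1 : Fin 2)), ((![k, m δ] : Site 2), (0 : Fin 2))) ∧ Z δ s((((![k, m δ - 1] : Site 2)), (1 : Fin 2)), ((![k, m δ] : Site 2), (0 : Fin 2))) ≤ C * Z δ (b δ)) ∧ (y.im = x.im → Metric.closedBall y ρ₀ ⊆ Metric.ball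 x r → ∃ C : ℝ, 0 < C ∧ ∀ᶠ δ : ℝ in 𝓝[>] 0, ∀ k : ℤ, (δ : ℂ) * hexMidpoint s((((![k, mr δ - 1] : Site 2)), (1 : Fin 2)), ((![k, mr δ] : Site 2), (0 : Fin 2))) ∈ Metric.ball y ρ₀ → C⁻¹ * Z δ (b δ) ≤ Z δ s((((![k, mr δ - 1] : Site 2)), (1 : Fin 2)), ((![k, mr δ] : Site 2), (0 : Fin 2))) ∧ Z δ s((((![k, mr δ - 1] : Site 2)), (1 : Fin 2)), ((![k, mr δ] : Site 2), (0 : Fin 2))) ≤ C * Z δ (b δ))) → (∃ κ : ℝ, 0 < κ ∧ ∀ η : ℝ, 0 < η → ∀ᶠ δ : ℝ in 𝓝[>] 0, ∀ k : ℤ, (δ : ℂ) * hexMidpoint s((((![k, mr δ - 1] : Site 2)), (1 : Fin 2)), ((![k, mr δ] : Site 2), (0 : Fin 2))) ∈ Metric.ball x (r / 2) → η < ((δ : ℂ) * hexMidpoint s((((![k, mr δ - 1] : Site 2)), (1 : Fin 2)), ((![k, mr δ] : Site 2), (0 : Fin 2)))).re - x.re → κ * Z δ (b δ) ≤ (((δ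 : ℂ) * hexMidpoint s((((![k, mr δ - 1] : Site 2)), (1 : Fin 2)), ((![k, mr δ] : Site 2), (0 : Fin 2)))).re - x.re) * Z δ s((((![k, mr δ - 1] : Site 2)), (1 : Fin 2)), ((![k, mr δ] : Site 2), (0 : Fin 2)))) → (∀ (y : ℂ) (ρ₀ : ℝ), 0 < ρ₀ → (y.im = c.im ∧ Metric.closedBall y ρ₀ ⊆ Metric.ball c ρ ∨ y.im = x.im ∧ Metric.closedBall y ρ₀ ⊆ Metric.ball x r) → x ∉ Metric.closedBall y (2 * ρ₀) → ∃ C : ℝ, 0 < C ∧ ∀ ρ' : ℝ, 0 < ρ' → ρ' ≤ ρ₀ → ∀ᶠ δ : ℝ in 𝓝[>] 0, C⁻¹ * ρ' * Z δ (b δ) ≤ δ * ∑ᶠ e' ∈ {e' : Sym2 HexVertex | e' ∈ hexDomainBoundary (Λ δ) ∧ (δ : ℂ) * hexMidpoint e' ∈ Metric.ball y ρ'}, Z δ e' ∧ δ * ∑ᶠ e' ∈ {e' : Sym2 HexVertex | e' ∈ hexDomainBoundary (Λ δ) ∧ (δ : ℂ) * hexMidpoint e' ∈ Metric.ball y ρ'},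 Z δ e' ≤ C * ρ' * Z δ (b δ)) ∧ (∀ A : ℝ, ∃ η : ℝ, 0 < η ∧ η < r / 2 ∧ ∀ᶠ δ : ℝ in 𝓝[>] 0, A * Z δ (b δ) ≤ δ * ∑ᶠ e' ∈ {e' : Sym2 HexVertex | e' ∈ hexDomainBoundary (Λ δ) ∧ (δ : ℂ) * hexMidpoint e' ∈ Metric.ball x (r / 2) ∧ x.re + η < ((δ : ℂ) * hexMidpoint e').re}, Z δ e') :=
  fun Λ m mr ρ r c x b e Z hρ hpin hb hblim hr hpinr he helim hZ hA hB =>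
    ⟨stub_flatMassLaws_densityReduction Λ m mr ρ r c x b e Z hρ hpin hb hblim hr hpinr he helim hZ hA,
      armDivergence_of_harmonic hr hpinr he helim hZ hB⟩

/-- **The flat mass laws from the two pointwise laws** (FAMILY LEVEL: the conclusion is verbatim the
body of `…Cruxes.BoundaryClosureR.PickHalfPlane.FlatMassLaws` (skeleton r3); the antecedents are
(a**) pointwise two-sided comparability on both flat pieces and (b*) the harmonic arm bound, under
the same binders with `AdmissibleFamily` / `PinnedFlatRoot` and `Z` written out), so that in the
skeleton `exact flatMassLaws_of_pointwise hA hB` closes `stub_flatMassLaws`.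
[cite: DuminilCopinSmirnov2012, §3 (the boundary part α of the strip)] -/
theorem flatMassLaws_of_pointwise
    (hA : ∀ (D : DobrushinDomain) (ρ : ℝ) (Λ : ℝ → Finset HexVertex) (m : ℝ → ℤ)
      (b : ℝ → Sym2 HexVertex),
      (0 < ρ ∧
      D.carrier ∩ Metric.ball (D.pt 1) ρ = {z : ℂ | (D.pt 1).im < z.im} ∩ Metric.ball (D.pt 1) ρ ∧
      (∀ᶠ δ : ℝ in 𝓝[>] 0, hexDomainSimplyConnected (Λ δ) ∧ b δ ∈ hexDomainBoundary (Λ δ) ∧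
          (hexGraph.induce ((Λ δ : Finset HexVertex) : Set HexVertex)).Preconnected ∧
          (∀ v ∈ Λ δ, (δ : ℂ) * hexCenter v ∈ D.carrier) ∧
          (∀ v : HexVertex, (δ : ℂ) * hexCenter v ∈ Metric.ball (D.pt 1) ρ → (v ∈ Λ δ ↔ m δ ≤ v.1 1))) ∧
      (∀ K : Set ℂ, IsCompact K → K ⊆ D.carrier →
          ∀ᶠ δ : ℝ in 𝓝[>] 0, ∀ v : HexVertex, (δ : ℂ) * hexCenter v ∈ K → v ∈ Λ δ) ∧
      Tendsto (fun δ : ℝ => (δ : ℂ) * hexMidpoint (b δ)) (𝓝[>] 0) (𝓝 (D.pt 1))) →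
      ∀ (x : ℂ) (e : ℝ → Sym2 HexVertex) (r : ℝ) (mr : ℝ → ℤ),
      (0 < r ∧
      D.carrier ∩ Metric.ball x r = {z : ℂ | x.im < z.im} ∩ Metric.ball x r ∧
      (∀ᶠ δ : ℝ in 𝓝[>] 0, e δ ∈ hexDomainBoundary (Λ δ) ∧ Nonempty (HexMidEdgeSAW (Λ δ) (e δ) (b δ)) ∧
          (∀ v : HexVertex, (δ : ℂ) * hexCenter v ∈ Metric.ball x r → (v ∈ Λ δ ↔ mr δ ≤ v.1 1))) ∧
      Tendsto (fun δ : ℝ => (δ : ℂ) * hexMidpoint (e δ)) (𝓝[>] 0) (𝓝 x)) → x ≠ D.pt 1 →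
      ∀ (y : ℂ) (ρ₀ : ℝ), 0 < ρ₀ → x ∉ Metric.closedBall y (2 * ρ₀) →
        (y.im = (D.pt 1).im → Metric.closedBall y ρ₀ ⊆ Metric.ball (D.pt 1) ρ →
          ∃ C : ℝ, 0 < C ∧ ∀ᶠ δ : ℝ in 𝓝[>] 0, ∀ k : ℤ,
            (δ : ℂ) * hexMidpoint s((((![k, m δ - 1] : Site 2)), (1 : Fin 2)), ((![k, m δ] : Site 2), (0 : Fin 2))) ∈ Metric.ball y ρ₀ →
            C⁻¹ * ‖hexParafermionicObservable (Λ δ) (e δ) hexCriticalFugacity 0 (b δ)‖ ≤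
                ‖hexParafermionicObservable (Λ δ) (e δ) hexCriticalFugacity 0 s((((![k, m δ - 1] : Site 2)), (1 : Fin 2)), ((![k, m δ] : Site 2), (0 : Fin 2)))‖ ∧
              ‖hexParafermionicObservable (Λ δ) (e δ) hexCriticalFugacity 0 s((((![k, m δ - 1] : Site 2)), (1 : Fin 2)), ((![k, m δ] : Site 2), (0 : Fin 2)))‖ ≤
                C * ‖hexParafermionicObservable (Λ δ) (e δ) hexCriticalFugacity 0 (b δ)‖) ∧
        (y.im = x.im → Metric.closedBall y ρ₀ ⊆ Metric.ball x r →
          ∃ C : ℝ, 0 < C ∧ ∀ᶠ δ : ℝ in 𝓝[>] 0, ∀ k : ℤ,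
            (δ : ℂ) * hexMidpoint s((((![k, mr δ - 1] : Site 2)), (1 : Fin 2)), ((![k, mr δ] : Site 2), (0 : Fin 2))) ∈ Metric.ball y ρ₀ →
            C⁻¹ * ‖hexParafermionicObservable (Λ δ) (e δ) hexCriticalFugacity 0 (b δ)‖ ≤
                ‖hexParafermionicObservable (Λ δ) (e δ) hexCriticalFugacity 0 s((((![k, mr δ - 1] : Site 2)), (1 : Fin 2)), ((![k, mr δ] : Site 2), (0 : Fin 2)))‖ ∧
              ‖hexParafermionicObservable (Λ δ) (e δ) hexCriticalFugacity 0 s((((![k, mr δ - 1] : Site 2)), (1 : Fin 2)), ((![k, mr δ] : Site 2), (0 : Fin 2)))‖ ≤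
                C * ‖hexParafermionicObservable (Λ δ) (e δ) hexCriticalFugacity 0 (b δ)‖))
    (hB : ∀ (D : DobrushinDomain) (ρ : ℝ) (Λ : ℝ → Finset HexVertex) (m : ℝ → ℤ)
      (b : ℝ → Sym2 HexVertex),
      (0 < ρ ∧
      D.carrier ∩ Metric.ball (D.pt 1) ρ = {z : ℂ | (D.pt 1).im < z.im} ∩ Metric.ball (D.pt 1) ρ ∧
      (∀ᶠ δ : ℝ in 𝓝[>] 0, hexDomainSimplyConnected (Λ δ) ∧ b δ ∈ hexDomainBoundary (Λ δ) ∧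
          (hexGraph.induce ((Λ δ : Finset HexVertex) : Set HexVertex)).Preconnected ∧
          (∀ v ∈ Λ δ, (δ : ℂ) * hexCenter v ∈ D.carrier) ∧
          (∀ v : HexVertex, (δ : ℂ) * hexCenter v ∈ Metric.ball (D.pt 1) ρ → (v ∈ Λ δ ↔ m δ ≤ v.1 1))) ∧
      (∀ K : Set ℂ, IsCompact K → K ⊆ D.carrier →
          ∀ᶠ δ : ℝ in 𝓝[>] 0, ∀ v : HexVertex, (δ : ℂ) * hexCenter v ∈ K → v ∈ Λ δ) ∧
      Tendsto (fun δ : ℝ => (δ : ℂ) * hexMidpoint (b δ)) (𝓝[>] 0) (𝓝 (D.pt 1))) →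
      ∀ (x : ℂ) (e : ℝ → Sym2 HexVertex) (r : ℝ) (mr : ℝ → ℤ),
      (0 < r ∧
      D.carrier ∩ Metric.ball x r = {z : ℂ | x.im < z.im} ∩ Metric.ball x r ∧
      (∀ᶠ δ : ℝ in 𝓝[>] 0, e δ ∈ hexDomainBoundary (Λ δ) ∧ Nonempty (HexMidEdgeSAW (Λ δ) (e δ) (b δ)) ∧
          (∀ v : HexVertex, (δ : ℂ) * hexCenter v ∈ Metric.ball x r → (v ∈ Λ δ ↔ mr δ ≤ v.1 1))) ∧
      Tendsto (fun δ : ℝ => (δ : ℂ) * hexMidpoint (e δ)) (𝓝[>] 0) (𝓝 x)) → x ≠ D.pt 1 →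
      ∃ κ : ℝ, 0 < κ ∧ ∀ η : ℝ, 0 < η → ∀ᶠ δ : ℝ in 𝓝[>] 0, ∀ k : ℤ,
        (δ : ℂ) * hexMidpoint s((((![k, mr δ - 1] : Site 2)), (1 : Fin 2)), ((![k, mr δ] : Site 2), (0 : Fin 2))) ∈ Metric.ball x (r / 2) →
        η < ((δ : ℂ) * hexMidpoint s((((![k, mr δ - 1] : Site 2)), (1 : Fin 2)), ((![k, mr δ] : Site 2), (0 : Fin 2)))).re - x.re →
        κ * ‖hexParafermionicObservable (Λ δ) (e δ) hexCriticalFugacity 0 (b δ)‖ ≤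
          (((δ : ℂ) * hexMidpoint s((((![k, mr δ - 1] : Site 2)), (1 : Fin 2)), ((![k, mr δ] : Site 2), (0 : Fin 2)))).re - x.re) *
            ‖hexParafermionicObservable (Λ δ) (e δ) hexCriticalFugacity 0 s((((![k, mr δ - 1] : Site 2)), (1 : Fin 2)), ((![k, mr δ] : Site 2), (0 : Fin 2)))‖) :
    ∀ (D : DobrushinDomain) (ρ : ℝ) (Λ : ℝ → Finset HexVertex) (m : ℝ → ℤ) (b : ℝ → Sym2 HexVertex),
      (0 < ρ ∧
      D.carrier ∩ Metric.ball (D.pt 1) ρ = {z : ℂ | (D.pt 1).im < z.im} ∩ Metric.ball (D.pt 1) ρ ∧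
      (∀ᶠ δ : ℝ in 𝓝[>] 0, hexDomainSimplyConnected (Λ δ) ∧ b δ ∈ hexDomainBoundary (Λ δ) ∧
          (hexGraph.induce ((Λ δ : Finset HexVertex) : Set HexVertex)).Preconnected ∧
          (∀ v ∈ Λ δ, (δ : ℂ) * hexCenter v ∈ D.carrier) ∧
          (∀ v : HexVertex, (δ : ℂ) * hexCenter v ∈ Metric.ball (D.pt 1) ρ → (v ∈ Λ δ ↔ m δ ≤ v.1 1))) ∧
      (∀ K : Set ℂ, IsCompact K → K ⊆ D.carrier →
          ∀ᶠ δ : ℝ in 𝓝[>] 0, ∀ v : HexVertex, (δ : ℂ) * hexCenter v ∈ K → v ∈ Λ δ) ∧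
      Tendsto (fun δ : ℝ => (δ : ℂ) * hexMidpoint (b δ)) (𝓝[>] 0) (𝓝 (D.pt 1))) →
    ∀ (x : ℂ) (e : ℝ → Sym2 HexVertex) (r : ℝ) (mr : ℝ → ℤ),
      (0 < r ∧
      D.carrier ∩ Metric.ball x r = {z : ℂ | x.im < z.im} ∩ Metric.ball x r ∧
      (∀ᶠ δ : ℝ in 𝓝[>] 0, e δ ∈ hexDomainBoundary (Λ δ) ∧ Nonempty (HexMidEdgeSAW (Λ δ) (e δ) (b δ)) ∧
          (∀ v : HexVertex, (δ : ℂ) * hexCenter v ∈ Metric.ball x r → (v ∈ Λ δ ↔ mr δ ≤ v.1 1))) ∧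
      Tendsto (fun δ : ℝ => (δ : ℂ) * hexMidpoint (e δ)) (𝓝[>] 0) (𝓝 x)) → x ≠ D.pt 1 →
    let Z : ℝ → Sym2 HexVertex → ℝ := fun δ z =>
      ‖hexParafermionicObservable (Λ δ) (e δ) hexCriticalFugacity 0 z‖
    (∀ (y : ℂ) (ρ₀ : ℝ), 0 < ρ₀ →
        (y.im = (D.pt 1).im ∧ Metric.closedBall y ρ₀ ⊆ Metric.ball (D.pt 1) ρ ∨
          y.im = x.im ∧ Metric.closedBall y ρ₀ ⊆ Metric.ball x r) →
        x ∉ Metric.closedBall y (2 * ρ₀) →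
      ∃ C : ℝ, 0 < C ∧ ∀ ρ' : ℝ, 0 < ρ' → ρ' ≤ ρ₀ → ∀ᶠ δ : ℝ in 𝓝[>] 0,
        C⁻¹ * ρ' * Z δ (b δ) ≤ δ * ∑ᶠ e' ∈ {e' : Sym2 HexVertex | e' ∈ hexDomainBoundary (Λ δ) ∧
            (δ : ℂ) * hexMidpoint e' ∈ Metric.ball y ρ'}, Z δ e' ∧
        δ * ∑ᶠ e' ∈ {e' : Sym2 HexVertex | e' ∈ hexDomainBoundary (Λ δ) ∧
            (δ : ℂ) * hexMidpoint e' ∈ Metric.ball y ρ'}, Z δ e' ≤ C * ρ' * Z δ (b δ)) ∧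
    (∀ A : ℝ, ∃ η : ℝ, 0 < η ∧ η < r / 2 ∧ ∀ᶠ δ : ℝ in 𝓝[>] 0,
        A * Z δ (b δ) ≤ δ * ∑ᶠ e' ∈ {e' : Sym2 HexVertex | e' ∈ hexDomainBoundary (Λ δ) ∧
            (δ : ℂ) * hexMidpoint e' ∈ Metric.ball x (r / 2) ∧
            x.re + η < ((δ : ℂ) * hexMidpoint e').re}, Z δ e') :=
  flatMassLaws_of_pointwise_of_arm hA (armDivergence_family hB)

end Summit.CriticalPhenomena.SAWScalingLimit.Theorems.PickHalfPlane.GateMass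

end
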